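import Mathlib
import Summits.CriticalPhenomena.PercolationContinuityZ3.Theorems.PercNearOneGluingNoHeavyLowerTailTreeEmbedding

/-!
# Causal (order) bijections: `OrderEmb l X Y` implies both a tree embedding and game domination along `l` (hp-7 gen 84)

Helper file for crux `stmt-CriticalPhenomena-4575` (`NoHeavyLowerTail`, route `PercNearOneGluingNoHeavy`), hull-port seat
`prim-hp-7` (generation 84); `--supports stmt-CriticalPhenomena-4575`.  Pure finite set theory; everything is PROVED.
Memo: `run/shared/lean/prim/prim-hp-7/FROM-prim-hp-7-g84-TREE-BIJECTION.md` §0 (B), §2.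

`OrderEmb m X Y` (the head of `m` is the OUTERMOST = first-played coordinate): `X ⊆ Y` for `m = []`; for `r :: m` the `r`-fibres of
`X` embed into the `r`-fibres of `Y` along `m`, straight or crossed.  A derivation is a *causal bijection* of the cube along the order
`m` — the flip of coordinate `r` is decided by the earlier coordinates only — mapping `X` into `Y`; it is the non-adaptive special case of
`TreeBijection.TreeEmb` (`treeEmb_of_orderEmb`).  **`dominates_reverse_of_orderEmb`**: a causal bijection along `m` transports winning
strategies of every quantifier game, so `GameCount.Dominates m.reverse X Y` (gen 83's word-wise game domination, whose list head is the
INNERMOST coordinate — hence the reversal).  The proof peels the outermost coordinate: `dominates_append_singleton_of_fibres` (domination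
along `l ++ [r]` from domination of the `r`-fibres along `l`, via the commutation of fibres with the doubled/projected children).
Consequently the gen-84 conjecture ORDER-EMB-∃ (some order admits a causal bijection `debtors ↪ resolved`; verified for all monotone maps on
`2^[4]` and ≈ 10⁶ instances on `2^[5..9]`) refines BOTH gen-83's K♯-GAME-∃ (`kSharp_of_debtorGameDomination`) and gen-84's tree-bijection
conjecture (`kSharp_of_debtorTreeEmbedding`): `kSharp_of_debtorOrderEmbedding`.
-/

namespace Summit.CriticalPhenomena.PercolationContinuityZ3.Theorems

namespace TreeBijection

open Finset TypedSectioning GameCount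

variable {α : Type*} [DecidableEq α]

/-- **Causal (order) embedding** along the list `m` (head = outermost coordinate): `X ⊆ Y` at the end; otherwise the `r`-fibres of `X`
embed into those of `Y` along the tail, straight (`0 ↦ 0`, `1 ↦ 1`) or crossed (`0 ↦ 1`, `1 ↦ 0`). -/
def OrderEmb : List α → Finset (Finset α) → Finset (Finset α) → Prop
  | [], X, Y => X ⊆ Y
  | r :: m, X, Y => (OrderEmb m (fib0 X r) (fib0 Y r) ∧ OrderEmb m (fib1 X r) (fib1 Y r)) ∨
      (OrderEmb m (fib0 X r) (fib1 Y r) ∧ OrderEmb m (fib1 X r) (fib0 Y r))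

/-- A causal embedding along a fixed order is a tree embedding. -/
theorem treeEmb_of_orderEmb {m : List α} {X Y : Finset (Finset α)} (h : OrderEmb m X Y) : TreeEmb X Y := by
  induction m generalizing X Y with
  | nil => unfold OrderEmb at h; exact TreeEmb.leaf X Y h
  | cons r m ih =>
    unfold OrderEmb at h
    rcases h with ⟨h₀, h₁⟩ | ⟨h₀, h₁⟩
    · exact TreeEmb.straight X Y r (ih h₀) (ih h₁)
    · exact TreeEmb.crossed X Y r (ih h₀) (ih h₁)

/-! #### Fibres commute with the doubled / projected children at a different coordinate -/

/-- `dbl` at `s` of the `0`-fibre at `r ≠ s` is the `0`-fibre of `dbl`. -/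
theorem dbl_fib0 (X : Finset (Finset α)) {r s : α} (hrs : r ≠ s) : dbl (fib0 X r) s = fib0 (dbl X s) r := by
  ext T
  rw [mem_dbl, mem_fib0, mem_fib0, mem_fib0, mem_dbl, mem_insert, not_or]
  constructor
  · rintro ⟨⟨h1, h2⟩, h3, h4, -, -⟩; exact ⟨⟨h1, h3, h4⟩, h2⟩
  · rintro ⟨⟨h1, h3, h4⟩, h2⟩; exact ⟨⟨h1, h2⟩, h3, h4, hrs, h2⟩

/-- `dbl` at `s` of the `1`-fibre at `r ≠ s` is the `1`-fibre of `dbl`. -/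
theorem dbl_fib1 (X : Finset (Finset α)) {r s : α} (hrs : r ≠ s) : dbl (fib1 X r) s = fib1 (dbl X s) r := by
  ext T
  rw [mem_dbl, mem_fib1, mem_fib1, mem_fib1, mem_dbl, mem_insert, not_or, mem_insert, not_or, Finset.insert_comm]
  constructor
  · rintro ⟨⟨h1, h2⟩, h3, ⟨-, -⟩, h4⟩; exact ⟨h1, h2, ⟨hrs.symm, h3⟩, h4⟩
  · rintro ⟨h1, h2, ⟨-, h3⟩, h4⟩; exact ⟨⟨h1, h2⟩, h3, ⟨hrs, h1⟩, h4⟩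

/-- `proj` at `s` of the `0`-fibre at `r ≠ s` is the `0`-fibre of `proj`. -/
theorem proj_fib0 (X : Finset (Finset α)) {r s : α} (hrs : r ≠ s) : proj (fib0 X r) s = fib0 (proj X s) r := by
  ext T
  rw [mem_proj, mem_fib0, mem_proj]
  constructor
  · rintro ⟨S, hS, rfl⟩
    rw [mem_fib0] at hS
    exact ⟨⟨S, hS.1, rfl⟩, fun h => hS.2 (mem_of_mem_erase h)⟩
  · rintro ⟨⟨S, hS, rfl⟩, hr⟩
    refine ⟨S, ?_, rfl⟩
    rw [mem_fib0]
    exact ⟨hS, fun h => hr (mem_erase.mpr ⟨hrs, h⟩)⟩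

/-- `proj` at `s` of the `1`-fibre at `r ≠ s` is the `1`-fibre of `proj`. -/
theorem proj_fib1 (X : Finset (Finset α)) {r s : α} (hrs : r ≠ s) : proj (fib1 X r) s = fib1 (proj X s) r := by
  ext T
  rw [mem_proj, mem_fib1, mem_proj]
  constructor
  · rintro ⟨S, hS, rfl⟩
    rw [mem_fib1] at hS
    refine ⟨fun h => hS.1 (mem_of_mem_erase h), insert r S, hS.2, ?_⟩
    rw [erase_insert_of_ne hrs]
  · rintro ⟨hr, S, hS, hST⟩
    have hrS : r ∈ S := by
      have : r ∈ S.erase s := by rw [hST]; exact mem_insert_self r T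
      exact mem_of_mem_erase this
    refine ⟨S.erase r, ?_, ?_⟩
    · rw [mem_fib1, insert_erase hrS]
      exact ⟨notMem_erase r S, hS⟩
    · rw [erase_right_comm, hST, erase_insert hr]

/-- `∅` lies in the doubled child at `r` iff it lies in both `r`-fibres. -/
theorem empty_mem_dbl_iff (X : Finset (Finset α)) (r : α) :
    (∅ : Finset α) ∈ dbl X r ↔ (∅ : Finset α) ∈ fib0 X r ∧ (∅ : Finset α) ∈ fib1 X r := by
  rw [mem_dbl, mem_fib0, mem_fib1]
  constructor
  · rintro ⟨h1, h2, h3⟩; exact ⟨⟨h1, h2⟩, h2, h3⟩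
  · rintro ⟨⟨h1, h2⟩, -, h3⟩; exact ⟨h1, h2, h3⟩

/-- `∅` lies in the projected child at `r` iff it lies in one of the `r`-fibres. -/
theorem empty_mem_proj_iff (X : Finset (Finset α)) (r : α) :
    (∅ : Finset α) ∈ proj X r ↔ (∅ : Finset α) ∈ fib0 X r ∨ (∅ : Finset α) ∈ fib1 X r := by
  rw [mem_proj, mem_fib0, mem_fib1]
  constructor
  · rintro ⟨S, hS, hSe⟩
    by_cases hr : r ∈ S
    · right
      refine ⟨notMem_empty r, ?_⟩
      have : insert r (S.erase r) = S := insert_erase hr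
      rw [hSe] at this
      rw [this]; exact hS
    · left
      have : S.erase r = S := erase_eq_of_notMem hr
      rw [this] at hSe
      subst hSe
      exact ⟨hS, hr⟩
  · rintro (⟨h1, -⟩ | ⟨-, h2⟩)
    · exact ⟨∅, h1, erase_empty r⟩
    · exact ⟨insert r ∅, h2, erase_insert (notMem_empty r)⟩

/-- **Peeling the outermost coordinate.**  If the `r`-fibres of `X` are dominated along `l` (`r ∉ l`) by the `r`-fibres of `Y`, straight
or crossed, then `Y` dominates `X` along `l ++ [r]` (the coordinate `r` played first = outermost). -/
theorem dominates_append_singleton_of_fibres :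
    ∀ (l : List α) {r : α}, r ∉ l → ∀ {X Y : Finset (Finset α)},
      ((Dominates l (fib0 X r) (fib0 Y r) ∧ Dominates l (fib1 X r) (fib1 Y r)) ∨
        (Dominates l (fib0 X r) (fib1 Y r) ∧ Dominates l (fib1 X r) (fib0 Y r))) →
      Dominates (l ++ [r]) X Y
  | [], r, _, X, Y, h => by
    rw [List.nil_append]
    unfold Dominates
    unfold Dominates at h
    unfold Dominates
    rw [empty_mem_dbl_iff, empty_mem_dbl_iff, empty_mem_proj_iff, empty_mem_proj_iff]
    rcases h with ⟨h₀, h₁⟩ | ⟨h₀, h₁⟩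
    · exact ⟨fun ⟨a, b⟩ => ⟨h₀ a, h₁ b⟩, fun hx => hx.elim (fun a => Or.inl (h₀ a)) (fun b => Or.inr (h₁ b))⟩
    · exact ⟨fun ⟨a, b⟩ => ⟨h₁ b, h₀ a⟩, fun hx => hx.elim (fun a => Or.inr (h₀ a)) (fun b => Or.inl (h₁ b))⟩
  | s :: l, r, hr, X, Y, h => by
    have hrs : r ≠ s := fun e => hr (e ▸ List.mem_cons_self)
    have hrl : r ∉ l := fun e => hr (List.mem_cons_of_mem s e)
    rw [List.cons_append]
    unfold Dominates
    unfold Dominates at h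
    rw [dbl_fib0 X hrs, dbl_fib0 Y hrs, dbl_fib1 X hrs, dbl_fib1 Y hrs, proj_fib0 X hrs, proj_fib0 Y hrs, proj_fib1 X hrs,
      proj_fib1 Y hrs] at h
    rcases h with ⟨⟨h00, h01⟩, h10, h11⟩ | ⟨⟨h00, h01⟩, h10, h11⟩
    · exact ⟨dominates_append_singleton_of_fibres l hrl (Or.inl ⟨h00, h10⟩),
        dominates_append_singleton_of_fibres l hrl (Or.inl ⟨h01, h11⟩)⟩
    · exact ⟨dominates_append_singleton_of_fibres l hrl (Or.inr ⟨h00, h10⟩),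
        dominates_append_singleton_of_fibres l hrl (Or.inr ⟨h01, h11⟩)⟩

/-- **A causal bijection transports every quantifier game** (hp-7 gen 84): `OrderEmb m X Y` along a duplicate-free order `m`
(head = outermost) gives gen-83's game domination `Dominates m.reverse X Y` (head = innermost). -/
theorem dominates_reverse_of_orderEmb {m : List α} (hm : m.Nodup) {X Y : Finset (Finset α)} (h : OrderEmb m X Y) :
    Dominates m.reverse X Y := by
  induction m generalizing X Y with
  | nil =>
    unfold OrderEmb at h
    rw [List.reverse_nil]
    unfold Dominates
    exact fun hx => h hx
  | cons r m ih =>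
    unfold OrderEmb at h
    have hnd : m.Nodup := (List.nodup_cons.mp hm).2
    have hrm : r ∉ m.reverse := fun e => (List.nodup_cons.mp hm).1 (List.mem_reverse.mp e)
    rw [List.reverse_cons]
    apply dominates_append_singleton_of_fibres m.reverse hrm
    rcases h with ⟨h₀, h₁⟩ | ⟨h₀, h₁⟩
    · exact Or.inl ⟨ih hnd h₀, ih hnd h₁⟩
    · exact Or.inr ⟨ih hnd h₀, ih hnd h₁⟩

end TreeBijection

/-! ### K♯ from a causal bijection `debtors ↪ resolved` (refines both gen-83 K♯-GAME-∃ and gen-84 tree bijections) -/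

namespace GeneratedDonors

open Finset OrientedAntipodalHall AntipodalStrongHarris AntipodalStrongHarris.Lab TreeBijection GameCount

variable {α : Type} [Fintype α] [DecidableEq α]

/-- A causal bijection `debtors ↪ resolved` along an enumeration of all coordinates yields gen-83's debtor-game domination hypothesis
(for the reversed order). -/
theorem dominates_of_orderEmb_debtors (g h : Finset α → Lab 3) (m : List α) (hm : m.Nodup)
    (hemb : OrderEmb m (debtors g h) (resolved g h)) : Dominates m.reverse (debtors g h) (resolved g h) :=
  dominates_reverse_of_orderEmb hm hemb

/-- **Conjecture K♯ follows from ORDER-EMB-∃** (hp-7 gen 84): if for every pair of monotone labellings some linear order of the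
coordinates admits a causal bijection of the cube mapping debtor sets to resolved sets, then `KSharp 3`.  (Via the tree embedding;
equivalently via `kSharp_of_debtorGameDomination` and `dominates_reverse_of_orderEmb`.) -/
theorem kSharp_of_debtorOrderEmbedding
    (H : ∀ (α : Type) [Fintype α] [DecidableEq α] (g h : Finset α → Lab 3),
      (∀ ⦃X Y : Finset α⦄, X ⊆ Y → g X ≤ g Y) → (∀ ⦃X Y : Finset α⦄, X ⊆ Y → h X ≤ h Y) →
        ∃ m : List α, OrderEmb m (debtors g h) (resolved g h)) :
    KSharp 3 := by
  apply kSharp_of_debtorTreeEmbedding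
  intro α _ _ g h hg hh
  obtain ⟨m, hm⟩ := H α g h hg hh
  exact treeEmb_of_orderEmb hm

end GeneratedDonors

end Summit.CriticalPhenomena.PercolationContinuityZ3.Theorems

/-! ### Addendum (hp-7 gen 84, same session): ORDER-EMB-∃ is FALSE in general

The census `kit84a` (j308561) found monotone maps on `2^[6]` (tight, non-pure; see the addendum of `…LowerTailTreeEmbedding` and memo
`FROM-prim-hp-7-g84-TREE-BIJECTION.md` §0 (B)) whose debtor family admits NO tree embedding — hence no causal bijection in any order — into the
resolved family, although 168 of the 720 orders dominate in the sense of `GameCount.Dominates`.  So `dominates_reverse_of_orderEmb` is a strict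
implication and the hypothesis of `kSharp_of_debtorOrderEmbedding` fails in general; the gen-83 game-domination conjecture K♯-GAME-∃ is unaffected
(0 failures, including 1.37·10⁶ adversarially minimised instances of gen 84). -/
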